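import Literature.NumberTheory.Transcendental.EllIterRep
import Literature.NumberTheory.Transcendental.KZUnfolding
import Literature.NumberTheory.Transcendental.MZVWordShuffle
import HarnessLib

/-!
# Genus-one iterated integrals: the shuffle product formula in the KZ calculus

Companion file of `EllIterRep.lean` (`KZ.ellIterRep γ w hw : KZ.IntegralRep n`, the iterated
integral `∫_γ φ₀ ⋯ φ_{n−1}` of a word of algebraic `1`-forms along a monotone arc `γ` of the real
oval of `y² = 4(x − e₁)(x − e₂)(x − e₃)`), answering the second half of the definition request
`defn-ellIterRep(-2)` of route KontsevichZagierPeriods/GenusOneIterated (items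
`stmt-KontsevichZagierPeriods-14125` EllGenerationR, `-8548` LemniscaticSectorKernel): the
**shuffle product formula** of Ree and Chen,

  `∫_γ φ₁ ⋯ φ_a · ∫_γ φ_{a+1} ⋯ φ_{a+b} = Σ_σ ∫_γ φ_{σ(1)} ⋯ φ_{σ(a+b)}`,

`σ` over the `(a+b)!/(a! b!)` shuffles (Chen 1977, (1.5.6); Ree 1958), holds **inside the
Kontsevich–Zagier calculus of moves** of `KZCalculus.lean`: the class of the product representation
minus the sum of the classes of the shuffled words lies in `KZ.relations`
(`KZ.of_ellIterRep_mul_of_ellIterRep_sub_sum_mem_relations`; list-word form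
`KZ.ellClass_mul_ellClass_sub_sum_mem_relations`; numerical corollary
`KZ.ellIterRep_value_mul_value`). The proof is the classical dissection of a product of two
simplices (Eie 2013, §1.2, for the simplices `0 < t₁ < ⋯ < t_n < 1` of multiple zeta values;
verbatim here for the ordered simplices `lo < x₀ < ⋯ < x_{n−1} < hi` of an arc):

* the product `[Δ_a(γ), ∏φᵢ(xᵢ)] · [Δ_b(γ), ∏ψⱼ(yⱼ)]` is the representation on `Δ_a(γ) × Δ_b(γ)`
  with integrand the product (`KZ.of_mul_of`, `KZ.IntegralRep.prod_integrand_eq`);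
* off the null tie walls `{xᵢ = yⱼ}` the product of simplices is the disjoint union of the
  SHUFFLE CELLS `{z | z ∘ e ∈ Δ_{a+b}(γ)}`, one for each sorting permutation `e` of `Fin (a + b)`
  whose label list is an interleaving of the two blocks of labels (`KZ.exists_enum_coordShuffles`,
  `KZ.mem_ellDomain_of_comp_mem_ellDomain`, `KZ.exists_comp_mem_ellDomain`,
  `KZ.ofFn_eq_of_comp_mem_ellDomain`), so that iterated domain additivity (rule (1a),
  `KZ.of_sub_sum_of_mem_relations_of_subset`) replaces the product by the sum of the cells;
* on a cell the product integrand is the word integrand of the merged word read along `e`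
  (`KZ.ellIntegrand_append_comp_equiv`; the orientation signs multiply, `σᵃσᵇ = σᵃ⁺ᵇ`), so each
  cell is ONE coordinate permutation (rule (2), `KZ.of_sub_of_reindex_mem_relations`) of the
  representation `KZ.ellIterRep` of the merged word;
* the merged words, listed along the coordinate shuffles, are the tree's recursive shuffle product
  `MZV.shuffleWord` of the two words with multiplicity (naturality `MZV.shuffleWord_map`).

The interleavings are indexed by `MZV.shuffleWord` (`MZVWordShuffle.lean`), whose elementary list
combinatorics (naturality, sublists, permutation of the concatenation, no duplicates, and the
merging lemma `MZV.exists_pairwise_mem_shuffleWord`) is proved here in the generality of an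
arbitrary alphabet. For LIST words the class `KZ.ellClass γ w ∈ KZ.FormalRep` of
`∫_γ w` (`= KZ.of (KZ.ellIterRep γ w.get _) `, an `IntegralRep w.length`; junk `0` for a word not
adapted to `γ`) is the shape in which sums over shuffles are written (as the `ρ` of the route item
`CoactionDevissage.Shuffle` for `KZ.mzvRep`).

## References

* K.-T. Chen, *Iterated path integrals*, Bull. Amer. Math. Soc. 83 (1977), 831–879: §1.5,
  formula (1.5.6), p. 842 ("the exterior multiplication of iterated integrals",
  `∫ω₁⋯ω_r ∧ ∫ω_{r+1}⋯ω_{r+s} = Σ ε_σ ∫ω_{σ(1)}⋯ω_{σ(r+s)}`, "summing over those permutations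
  `σ` of `r + s` letters with `σ⁻¹(1) < ⋯ < σ⁻¹(r)`, `σ⁻¹(r+1) < ⋯ < σ⁻¹(r+s)`"; for `1`-forms all
  signs `ε_σ` are `+1`), after Ree [57]. [Chen1977]
* R. Ree, *Lie elements and an algebra associated with shuffles*, Ann. of Math. 68 (1958),
  210–220 (the shuffle algebra of iterated integrals).
* M. Eie, *The Theory of Multiple Zeta Values with Applications in Combinatorics* (2013), §1.2
  (the shuffle product formula as the decomposition of a product of two simplices). [Eie2013]
* M. Kontsevich, D. Zagier, *Periods* (2001), §1.2, rules (1)–(2). [KontsevichZagier2001]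
* C. Reutenauer, *Free Lie Algebras* (1993), §1.4 (the recursion of `ш`). [Reutenauer1993]

## Design notes

* Nothing of `EllIterRep.lean` is redefined: words are vectors `Fin n → KZ.EllLetter`, the merged
  word of a coordinate shuffle `e` is `Fin.append u v ∘ e`, and list words enter only through
  `KZ.ellClass` and `List.ofFn` / `List.get`.
* The orientation of the arc is handled once, through the order of visit `KZ.EllArc.Precedes γ`
  (`s < t` on a forward arc, `t < s` on a backward arc): `KZ.mem_ellDomain_iff_forall_precedes`.
* The Summit-side proof of the same dissection for `KZ.mzvRep`
  (`Theorems/MzvKernelInKZTwoPosetsShuffleProduct*.lean`) cannot be imported into `Literature`;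
  the combinatorial lemmas are re-proved here under `MZV.` / `KZ.` names.
* Imports are kept to those of `EllIterRepReversal.lean` (`KZUnfolding`, over `KZProductIdeal`)
  plus `MZVWordShuffle`: the finite-almost-partition bookkeeping of rule (1a)
  (`KZ.of_sub_sum_of_mem_relations` of `KZSemiCanonicalReductionProofs.lean`) is re-proved below
  in the exact-inclusion form used here (`KZ.of_sub_sum_of_mem_relations_of_subset`) rather than imported, so that
  route files importing this vocabulary do not acquire the module cone of the Viu-Sos reduction
  (`KZVolumeConjecture`, `KZLogCalculus`, `PeriodCompactDomain`, …).
-/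

noncomputable section

open MeasureTheory Set
open Literature.ModelTheory.ExponentialFields (IsSemialgebraic)

namespace Literature.NumberTheory.Transcendental

/-! ### List combinatorics of the shuffle product -/

namespace MZV

variable {α β : Type*}

/-- Naturality of the shuffle product under a relabelling of the letters:
`(map f u) ш (map f v) = map (map f) (u ш v)`. [Reutenauer 1993, §1.4] [folklore] -/
theorem shuffleWord_map (f : α → β) : ∀ (u v : List α),
    shuffleWord (u.map f) (v.map f) = (shuffleWord u v).map (List.map f)
  | [], v => by simp
  | a :: u, [] => by simp
  | a :: u, b :: v => by
    have h₁ := shuffleWord_map f u (b :: v)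
    have h₂ := shuffleWord_map f (a :: u) v
    simp only [List.map_cons] at h₁ h₂ ⊢
    rw [shuffleWord_cons_cons, shuffleWord_cons_cons, h₁, h₂]
    simp only [List.map_append, List.map_map, Function.comp_def, List.map_cons]

/-- Both factors are sublists of each of their interleavings. [Reutenauer 1993, §1.4] [folklore] -/
theorem sublist_of_mem_shuffleWord : ∀ (u v : List α) {w : List α}, w ∈ shuffleWord u v →
    u.Sublist w ∧ v.Sublist w
  | [], v, w, hw => by
    simp only [shuffleWord_nil_left, List.mem_singleton] at hw
    subst hw
    exact ⟨List.nil_sublist _, List.Sublist.refl _⟩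
  | a :: u, [], w, hw => by
    simp only [shuffleWord_nil_right, List.mem_singleton] at hw
    subst hw
    exact ⟨List.Sublist.refl _, List.nil_sublist _⟩
  | a :: u, b :: v, w, hw => by
    simp only [shuffleWord_cons_cons, List.mem_append, List.mem_map] at hw
    rcases hw with ⟨w', hw', rfl⟩ | ⟨w', hw', rfl⟩
    · have ih := sublist_of_mem_shuffleWord u (b :: v) hw'
      exact ⟨ih.1.cons_cons a, ih.2.cons a⟩
    · have ih := sublist_of_mem_shuffleWord (a :: u) v hw'
      exact ⟨ih.1.cons b, ih.2.cons_cons b⟩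

/-- Each interleaving of `u` and `v` is a permutation of `u ++ v`. [Reutenauer 1993, §1.4]
[folklore] -/
theorem perm_of_mem_shuffleWord : ∀ (u v : List α) {w : List α}, w ∈ shuffleWord u v →
    w.Perm (u ++ v)
  | [], v, w, hw => by
    simp only [shuffleWord_nil_left, List.mem_singleton] at hw
    subst hw
    exact List.Perm.refl _
  | a :: u, [], w, hw => by
    simp only [shuffleWord_nil_right, List.mem_singleton] at hw
    subst hw
    rw [List.append_nil]
  | a :: u, b :: v, w, hw => by
    simp only [shuffleWord_cons_cons, List.mem_append, List.mem_map] at hw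
    rcases hw with ⟨w', hw', rfl⟩ | ⟨w', hw', rfl⟩
    · exact (perm_of_mem_shuffleWord u (b :: v) hw').cons a
    · exact ((perm_of_mem_shuffleWord (a :: u) v hw').cons b).trans List.perm_middle.symm

/-- The interleavings of two lists without repeated or common letters are pairwise distinct (as a
list, `u ш v` has no duplicates). [folklore] -/
theorem nodup_shuffleWord : ∀ (u v : List α), (u ++ v).Nodup → (shuffleWord u v).Nodup
  | [], v, _ => List.nodup_singleton _
  | a :: u, [], _ => by
    rw [shuffleWord_nil_right]
    exact List.nodup_singleton _
  | a :: u, b :: v, h => by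
    have h' : (a :: (u ++ b :: v)).Nodup := h
    have hab : a ≠ b := fun hab =>
      (List.nodup_cons.1 h').1 (hab ▸ List.mem_append_right u List.mem_cons_self)
    have h₂ : ((a :: u) ++ v).Nodup := (List.nodup_cons.1 (List.perm_middle.nodup_iff.1 h)).2
    rw [shuffleWord_cons_cons, List.nodup_append]
    refine ⟨(nodup_shuffleWord u (b :: v) (List.nodup_cons.1 h').2).map List.cons_injective,
      (nodup_shuffleWord (a :: u) v h₂).map List.cons_injective, fun x hx y hy hxy => ?_⟩
    obtain ⟨x', -, rfl⟩ := List.mem_map.1 hx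
    obtain ⟨y', -, rfl⟩ := List.mem_map.1 hy
    exact hab (List.head_eq_of_cons_eq hxy)

/-- **Merging lemma.** For a transitive relation `R`: if `u` and `v` are `R`-sorted and every
letter of `u` is `R`-comparable with every letter of `v`, some interleaving of `u` and `v` is
`R`-sorted (merge step of merge sort). [folklore] -/
theorem exists_pairwise_mem_shuffleWord {R : α → α → Prop}
    (htrans : ∀ a b c : α, R a b → R b c → R a c) : ∀ (u v : List α),
    u.Pairwise R → v.Pairwise R → (∀ m ∈ u, ∀ m' ∈ v, R m m' ∨ R m' m) →
    ∃ w ∈ shuffleWord u v, w.Pairwise R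
  | [], v, _, hv, _ => ⟨v, by simp, hv⟩
  | a :: u, [], hu, _, _ => ⟨a :: u, by simp, hu⟩
  | a :: u, b :: v, hu, hv, htot => by
    rw [List.pairwise_cons] at hu hv
    rcases htot a List.mem_cons_self b List.mem_cons_self with h | h
    · -- `R a b`: the letter `a` comes first
      obtain ⟨w, hw, hs⟩ := exists_pairwise_mem_shuffleWord (R := R) htrans u (b :: v)
        hu.2 (List.pairwise_cons.2 hv)
        fun m hm m' hm' => htot m (List.mem_cons_of_mem _ hm) m' hm'
      refine ⟨a :: w, ?_, List.pairwise_cons.2 ⟨fun m hm => ?_, hs⟩⟩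
      · rw [shuffleWord_cons_cons]
        exact List.mem_append_left _ (List.mem_map.2 ⟨w, hw, rfl⟩)
      · rcases List.mem_append.1 ((perm_of_mem_shuffleWord _ _ hw).mem_iff.1 hm) with hm | hm
        · exact hu.1 m hm
        · rcases List.mem_cons.1 hm with rfl | hm
          · exact h
          · exact htrans _ _ _ h (hv.1 m hm)
    · -- `R b a`: the letter `b` comes first
      obtain ⟨w, hw, hs⟩ := exists_pairwise_mem_shuffleWord (R := R) htrans (a :: u) v
        (List.pairwise_cons.2 hu) hv.2
        fun m hm m' hm' => htot m hm m' (List.mem_cons_of_mem _ hm')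
      refine ⟨b :: w, ?_, List.pairwise_cons.2 ⟨fun m hm => ?_, hs⟩⟩
      · rw [shuffleWord_cons_cons]
        exact List.mem_append_right _ (List.mem_map.2 ⟨w, hw, rfl⟩)
      · rcases List.mem_append.1 ((perm_of_mem_shuffleWord _ _ hw).mem_iff.1 hm) with hm | hm
        · rcases List.mem_cons.1 hm with rfl | hm
          · exact h
          · exact htrans _ _ _ h (hu.1 m hm)
        · exact hv.1 m hm

end MZV

namespace KZ

variable {E : EllCurve} {n a b : ℕ}

/-! ### Bookkeeping: iterated domain additivity over a finite partition (rule (1a)) -/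

/-- **Iterated domain additivity over a finite partition up to a null set.** If the domains of the
`Rᵢ` (`i ∈ s`) are subsets of the domain of `r`, pairwise disjoint, cover it up to a Lebesgue-null
set, and each `Rᵢ` carries the integrand of `r` on its own domain, then
`[r] − ∑ᵢ [Rᵢ] ∈ relations`: peel off one piece at a time by rule (1a) (`KZ.domainAddRel`),
identify `[r|_{σᵢ}]` with `[Rᵢ]` by rule (1b) against the zero representation (level junk,
`KZ.of_mem_levelRel_of_eqOn_zero`), and discard the null remainder
(`KZ.of_mem_levelRel_of_volume_eq_zero`). (The exact-inclusion case of
`KZ.of_sub_sum_of_mem_relations` of `KZSemiCanonicalReductionProofs.lean`, proved here over the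
imports of this file.) [Kontsevich–Zagier 2001, §1.2, rule (1)]
[cite: KontsevichZagier2001, §1.2 rule (1)] -/
theorem of_sub_sum_of_mem_relations_of_subset {ι : Type*} (s : Finset ι) :
    ∀ (r : IntegralRep n) (R : ι → IntegralRep n),
      (∀ i ∈ s, (R i).domain ⊆ r.domain) →
      (∀ i ∈ s, EqOn (R i).integrand r.integrand (R i).domain) →
      volume (r.domain \ ⋃ i ∈ s, (R i).domain) = 0 →
      (s : Set ι).Pairwise (fun i j => Disjoint (R i).domain (R j).domain) →
      of r - ∑ i ∈ s, of (R i) ∈ relations := by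
  classical
  induction s using Finset.induction_on with
  | empty =>
    intro r R _ _ hcov _
    simp only [Finset.notMem_empty, iUnion_of_empty, iUnion_empty, sdiff_empty] at hcov
    simpa using levelRel_le_relations (of_mem_levelRel_of_volume_eq_zero r hcov)
  | insert a s ha ih =>
    intro r R hdom hint hcov hdisj
    have ha' : (R a).domain ⊆ r.domain := hdom a (Finset.mem_insert_self a s)
    have hB : IsSemialgebraic ℚ (r.domain \ (R a).domain) :=
      r.isSemialgebraic_domain.diff (R a).isSemialgebraic_domain
    set r₁ := r.restrict (R a).domain (R a).isSemialgebraic_domain ha' with hr₁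
    set r₂ := r.restrict _ hB sdiff_subset with hr₂
    -- rule (1a): `[r] − [r₁] − [r₂]`
    have hsplit : of r - of r₁ - of r₂ ∈ relations := by
      refine domainAddRel_subset_relations ⟨n, r, r₁, r₂, ?_, ?_, fun _ _ => rfl, fun _ _ => rfl, rfl⟩
      · rw [hr₁, hr₂, IntegralRep.domain_restrict, IntegralRep.domain_restrict, union_sdiff_self,
          union_eq_right.2 ha']
      · rw [show r₁.domain ∩ r₂.domain = ∅ from
          eq_empty_of_forall_notMem fun x hx => hx.2.2 hx.1, measure_empty]
    -- rule (1b): `[r₁] − [R a]` — same domain, integrands agree on it, zero representation junk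
    have h₁ : of r₁ - of (R a) ∈ relations := by
      let z : IntegralRep n := ⟨(R a).domain, 0, (R a).isSemialgebraic_domain,
        (isSemialgebraicFunOn_aeval (R a).isSemialgebraic_domain 0).congr fun x _ => by simp,
        integrableOn_zero⟩
      have e1 : of r₁ - of (R a) - of z ∈ relations := by
        refine integrandAddRel_subset_relations ⟨n, r₁, R a, z, rfl, rfl, fun x hx => ?_, rfl⟩
        have hx' : x ∈ (R a).domain := hx
        have hfx : r.integrand x = (R a).integrand x :=
          (hint a (Finset.mem_insert_self a s) hx').symm
        have hz0 : z.integrand x = 0 := rfl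
        rw [Pi.add_apply, hz0, add_zero]
        exact hfx
      have e2 : of z ∈ relations :=
        levelRel_le_relations (of_mem_levelRel_of_eqOn_zero z fun _ _ => rfl)
      have : of r₁ - of (R a) = (of r₁ - of (R a) - of z) + of z := by abel
      rw [this]
      exact relations.add_mem e1 e2
    -- the induction hypothesis for `r₂`
    have h₂ : of r₂ - ∑ i ∈ s, of (R i) ∈ relations := by
      refine ih r₂ R (fun i hi x hx => ⟨hdom i (Finset.mem_insert_of_mem hi) hx, fun hxa => ?_⟩)
        (fun i hi => hint i (Finset.mem_insert_of_mem hi)) ?_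
        (hdisj.mono (Finset.coe_subset.mpr (Finset.subset_insert a s)))
      · exact Set.disjoint_left.1 (hdisj (Finset.mem_insert_of_mem hi)
          (Finset.mem_insert_self a s) (fun h => ha (h ▸ hi))) hx hxa
      · have : r₂.domain \ ⋃ i ∈ s, (R i).domain =
            r.domain \ ⋃ i ∈ insert a s, (R i).domain := by
          rw [Finset.set_biUnion_insert, hr₂, IntegralRep.domain_restrict, sdiff_sdiff_left]
          rfl
        rw [this]
        exact hcov
    rw [Finset.sum_insert ha]
    have : of r - (of (R a) + ∑ i ∈ s, of (R i)) =
        (of r - of r₁ - of r₂) + (of r₁ - of (R a)) + (of r₂ - ∑ i ∈ s, of (R i)) := by abel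
    rw [this]
    exact relations.add_mem (relations.add_mem hsplit h₁) h₂

/-! ### The order in which an arc visits abscissae -/

namespace EllArc

variable (γ : EllArc E)

/-- The order of visit of abscissae along the arc: `γ.Precedes s t` iff the arc passes over `s`
before `t`, i.e. `s < t` for a forward arc and `t < s` for a backward arc. The domain
`KZ.ellDomain γ n` is the set of tuples in `(lo, hi)ⁿ` increasing for this order
(`KZ.mem_ellDomain_iff_forall_precedes`). [Chen 1977, §1.1] [folklore] -/
def Precedes (s t : ℝ) : Prop := bif γ.forward then s < t else t < s

variable {γ}

/-- The order of visit is irreflexive. [folklore] -/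
theorem precedes_irrefl (s : ℝ) : ¬ γ.Precedes s s := by
  unfold Precedes; cases γ.forward <;> simp

/-- The order of visit is transitive. [folklore] -/
theorem Precedes.trans {s t u : ℝ} (h₁ : γ.Precedes s t) (h₂ : γ.Precedes t u) :
    γ.Precedes s u := by
  unfold Precedes at *
  cases hf : γ.forward <;> simp only [hf, cond_true, cond_false] at h₁ h₂ ⊢
  · exact lt_trans h₂ h₁
  · exact lt_trans h₁ h₂

/-- The order of visit is asymmetric. [folklore] -/
theorem Precedes.asymm {s t : ℝ} (h : γ.Precedes s t) : ¬ γ.Precedes t s :=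
  fun h' => precedes_irrefl s (h.trans h')

/-- Distinct abscissae are comparable in the order of visit. [folklore] -/
theorem precedes_or_precedes_of_ne {s t : ℝ} (h : s ≠ t) : γ.Precedes s t ∨ γ.Precedes t s := by
  unfold Precedes
  cases γ.forward
  · simpa [or_comm] using lt_or_gt_of_ne h
  · simpa using lt_or_gt_of_ne h

end EllArc

/-- **The domain through the order of visit**: `x ∈ Δ_n(γ)` iff all coordinates lie in `(lo, hi)`
and `x` is increasing for the order of visit `γ.Precedes`. [Chen 1977, §1.1] [folklore] -/
theorem mem_ellDomain_iff_forall_precedes (γ : EllArc E) (x : Fin n → ℝ) :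
    x ∈ ellDomain γ n ↔
      (∀ i, γ.lo < x i ∧ x i < γ.hi) ∧ ∀ ⦃i j : Fin n⦄, i < j → γ.Precedes (x i) (x j) := by
  rw [mem_ellDomain_iff]
  unfold EllArc.Precedes
  cases γ.forward
  · simp only [cond_false]
    exact ⟨fun ⟨h₁, h₂, h₃⟩ => ⟨fun i => ⟨h₁ i, h₂ i⟩, fun i j hij => h₃ hij⟩,
      fun ⟨h, h₃⟩ => ⟨fun i => (h i).1, fun i => (h i).2, fun i j hij => h₃ hij⟩⟩
  · simp only [cond_true]
    exact ⟨fun ⟨h₁, h₂, h₃⟩ => ⟨fun i => ⟨h₁ i, h₂ i⟩, fun i j hij => h₃ hij⟩,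
      fun ⟨h, h₃⟩ => ⟨fun i => (h i).1, fun i => (h i).2, fun i j hij => h₃ hij⟩⟩

/-! ### Sorting permutations: the shuffle cells of the ordered simplex of an arc -/

/-- A list enumerating `Fin n` (a permutation of `finRange n`) is the list of values of a
permutation of `Fin n`. [folklore] -/
theorem exists_equiv_of_perm_finRange {w : List (Fin n)} (hw : w.Perm (List.finRange n)) :
    ∃ e : Fin n ≃ Fin n, List.ofFn e = w := by
  have hlen : w.length = n := by rw [hw.length_eq, List.length_finRange]
  refine ⟨(finCongr hlen.symm).trans (List.Nodup.getEquivOfForallMemList w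
    (hw.nodup_iff.2 (List.nodup_finRange n)) fun m => hw.mem_iff.2 (List.mem_finRange m)), ?_⟩
  exact List.ext_getElem (by simp [hlen]) fun i h₁ h₂ => by simp

/-- The list of values of a permutation of `Fin n` is a permutation of `finRange n`. [folklore] -/
theorem ofFn_perm_finRange (e : Fin n ≃ Fin n) : (List.ofFn e).Perm (List.finRange n) := by
  rw [List.ofFn_eq_map]
  exact Equiv.Perm.map_finRange_perm e

/-- **The shuffle cell of a sorting permutation.** A tuple read along a permutation `e` of the
coordinates lies in the ordered simplex `Δ_n(γ)` of the arc iff all its coordinates lie in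
`(lo, hi)` and the label list `ofFn e` is sorted by the order of visit. [Eie 2013, §1.2]
[folklore] -/
theorem comp_mem_ellDomain_iff (γ : EllArc E) (e : Fin n ≃ Fin n) {z : Fin n → ℝ} :
    (fun k => z (e k)) ∈ ellDomain γ n ↔
      (∀ m, γ.lo < z m ∧ z m < γ.hi) ∧ (List.ofFn e).Pairwise (fun m m' => γ.Precedes (z m) (z m')) := by
  rw [mem_ellDomain_iff_forall_precedes, List.pairwise_ofFn]
  constructor
  · rintro ⟨h01, h2⟩
    exact ⟨fun m => by simpa using h01 (e.symm m), fun i j hij => h2 hij⟩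
  · rintro ⟨h01, h2⟩
    exact ⟨fun k => h01 _, fun i j hij => h2 hij⟩

/-- **Distinct sorting permutations have disjoint cells**: a tuple read in the simplex along two
permutations has pairwise distinct coordinates, enumerated in the order of visit by exactly one
label list. [folklore] -/
theorem ofFn_eq_of_comp_mem_ellDomain (γ : EllArc E) {e₁ e₂ : Fin n ≃ Fin n} {z : Fin n → ℝ}
    (h₁ : (fun k => z (e₁ k)) ∈ ellDomain γ n) (h₂ : (fun k => z (e₂ k)) ∈ ellDomain γ n) :
    List.ofFn e₁ = List.ofFn e₂ :=
  List.Perm.eq_of_pairwise (le := fun m m' => γ.Precedes (z m) (z m'))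
    (fun _ _ _ _ h h' => absurd h' (EllArc.Precedes.asymm h)) ((comp_mem_ellDomain_iff γ e₁).1 h₁).2
    ((comp_mem_ellDomain_iff γ e₂).1 h₂).2
    ((ofFn_perm_finRange e₁).trans (ofFn_perm_finRange e₂).symm)

/-- A diagonal hyperplane `{y i = y j}` (`i ≠ j`) of `ℝⁿ` is Lebesgue-null (a proper linear
subspace, `Measure.addHaar_submodule`). [folklore] -/
theorem volume_setOf_apply_eq_apply {i j : Fin n} (hij : i ≠ j) :
    volume {y : Fin n → ℝ | y i = y j} = 0 := by
  let L : (Fin n → ℝ) →ₗ[ℝ] ℝ :=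
    LinearMap.proj (R := ℝ) (φ := fun _ : Fin n => ℝ) i -
      LinearMap.proj (R := ℝ) (φ := fun _ : Fin n => ℝ) j
  have hL : ∀ y, L y = y i - y j := fun y => rfl
  have hset : {y : Fin n → ℝ | y i = y j} = (LinearMap.ker L : Set (Fin n → ℝ)) := by
    ext y
    simp [hL, sub_eq_zero]
  rw [hset]
  refine Measure.addHaar_submodule volume (LinearMap.ker L) fun htop => ?_
  have hmem : (Pi.single i 1 : Fin n → ℝ) ∈ LinearMap.ker L := htop ▸ Submodule.mem_top
  rw [LinearMap.mem_ker, hL, Pi.single_eq_same, Pi.single_eq_of_ne hij.symm, sub_zero] at hmem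
  exact one_ne_zero hmem

/-! ### Coordinate shuffles of `ℝᵃ × ℝᵇ` -/

/-- The two label lists (first block `castAdd b`, second block `natAdd a`) concatenate to
`finRange (a + b)`. [folklore] -/
theorem ofFn_castAdd_append_ofFn_natAdd (a b : ℕ) :
    List.ofFn (Fin.castAdd b : Fin a → Fin (a + b)) ++
        List.ofFn (Fin.natAdd a : Fin b → Fin (a + b)) = List.finRange (a + b) := by
  rw [← List.ofFn_fin_append, ← List.ofFn_id]
  congr 1
  funext m
  refine Fin.addCases (fun i => ?_) (fun j => ?_) m <;> simp

/-- **Enumeration of the coordinate shuffles by sorting permutations.** The interleavings of the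
two label lists (the tree's recursive `MZV.shuffleWord`, here without repetitions) are enumerated
bijectively by a finite family of permutations of `Fin (a + b)` through `e ↦ ofFn e`. [folklore] -/
theorem exists_enum_coordShuffles (a b : ℕ) :
    ∃ (N : ℕ) (e : Fin N → (Fin (a + b) ≃ Fin (a + b))),
      (∀ i, List.ofFn (e i) ∈
        MZV.shuffleWord (List.ofFn (Fin.castAdd b : Fin a → Fin (a + b)))
          (List.ofFn (Fin.natAdd a))) ∧
      (∀ i j, List.ofFn (e i) = List.ofFn (e j) → i = j) ∧
      ∀ w ∈ MZV.shuffleWord (List.ofFn (Fin.castAdd b : Fin a → Fin (a + b)))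
        (List.ofFn (Fin.natAdd a)), ∃ i, List.ofFn (e i) = w := by
  set L := MZV.shuffleWord (List.ofFn (Fin.castAdd b : Fin a → Fin (a + b)))
    (List.ofFn (Fin.natAdd a)) with hL
  have hnd : L.Nodup :=
    MZV.nodup_shuffleWord _ _
      (by rw [ofFn_castAdd_append_ofFn_natAdd]; exact List.nodup_finRange _)
  have hperm : ∀ i : Fin L.length, (L[(i : ℕ)]).Perm (List.finRange (a + b)) := fun i =>
    ofFn_castAdd_append_ofFn_natAdd a b ▸ MZV.perm_of_mem_shuffleWord _ _ (List.getElem_mem i.2)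
  choose e he using fun i : Fin L.length => exists_equiv_of_perm_finRange (hperm i)
  refine ⟨L.length, e, fun i => ?_, fun i j h => ?_, fun w hw => ?_⟩
  · rw [he]
    exact List.getElem_mem i.2
  · rw [he, he] at h
    exact Fin.ext (hnd.getElem_inj_iff.1 h)
  · obtain ⟨i, hi, rfl⟩ := List.mem_iff_getElem.1 hw
    exact ⟨⟨i, hi⟩, he ⟨i, hi⟩⟩

/-- **Cells lie in the product of simplices**: the sub-tuples `x`, `y` of a tuple read in the
order of visit along a coordinate shuffle are themselves sorted. [Eie 2013, §1.2] [folklore] -/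
theorem mem_ellDomain_of_comp_mem_ellDomain (γ : EllArc E) {e : Fin (a + b) ≃ Fin (a + b)}
    (he : List.ofFn e ∈ MZV.shuffleWord (List.ofFn (Fin.castAdd b : Fin a → Fin (a + b)))
      (List.ofFn (Fin.natAdd a)))
    {z : Fin (a + b) → ℝ} (hz : (fun k => z (e k)) ∈ ellDomain γ (a + b)) :
    (fun i => z (Fin.castAdd b i)) ∈ ellDomain γ a ∧
      (fun j => z (Fin.natAdd a j)) ∈ ellDomain γ b := by
  rw [comp_mem_ellDomain_iff] at hz
  obtain ⟨hb, hs⟩ := hz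
  obtain ⟨hl, hr⟩ := MZV.sublist_of_mem_shuffleWord _ _ he
  have hl' := List.pairwise_ofFn.1 (hs.sublist hl)
  have hr' := List.pairwise_ofFn.1 (hs.sublist hr)
  rw [mem_ellDomain_iff_forall_precedes, mem_ellDomain_iff_forall_precedes]
  exact ⟨⟨fun i => hb _, fun i j hij => hl' hij⟩, ⟨fun j => hb _, fun i j hij => hr' hij⟩⟩

/-- **The cells cover the product of simplices off the walls**: if `x ∈ Δ_a(γ)`, `y ∈ Δ_b(γ)` and
no `xᵢ` equals a `yⱼ`, the merged tuple is sorted along some coordinate shuffle (merging lemma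
`MZV.exists_pairwise_mem_shuffleWord` for the order of visit). [Eie 2013, §1.2] [folklore] -/
theorem exists_comp_mem_ellDomain (γ : EllArc E) {z : Fin (a + b) → ℝ}
    (hx : (fun i => z (Fin.castAdd b i)) ∈ ellDomain γ a)
    (hy : (fun j => z (Fin.natAdd a j)) ∈ ellDomain γ b)
    (hne : ∀ i j, z (Fin.castAdd b i) ≠ z (Fin.natAdd a j)) :
    ∃ e : Fin (a + b) ≃ Fin (a + b),
      List.ofFn e ∈ MZV.shuffleWord (List.ofFn (Fin.castAdd b : Fin a → Fin (a + b)))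
          (List.ofFn (Fin.natAdd a)) ∧
        (fun k => z (e k)) ∈ ellDomain γ (a + b) := by
  rw [mem_ellDomain_iff_forall_precedes] at hx hy
  obtain ⟨w, hw, hs⟩ := MZV.exists_pairwise_mem_shuffleWord
    (R := fun m m' : Fin (a + b) => γ.Precedes (z m) (z m')) (fun _ _ _ h h' => h.trans h')
    (List.ofFn (Fin.castAdd b : Fin a → Fin (a + b)))
    (List.ofFn (Fin.natAdd a : Fin b → Fin (a + b)))
    (List.pairwise_ofFn.2 fun i j hij => hx.2 hij)
    (List.pairwise_ofFn.2 fun i j hij => hy.2 hij)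
    (fun m hm m' hm' => by
      obtain ⟨i, rfl⟩ := List.mem_ofFn.1 hm
      obtain ⟨j, rfl⟩ := List.mem_ofFn.1 hm'
      exact EllArc.precedes_or_precedes_of_ne (hne i j))
  obtain ⟨e, rfl⟩ := exists_equiv_of_perm_finRange
    (ofFn_castAdd_append_ofFn_natAdd a b ▸ MZV.perm_of_mem_shuffleWord _ _ hw)
  refine ⟨e, hw, (comp_mem_ellDomain_iff γ e).2 ⟨fun m => ?_, hs⟩⟩
  refine Fin.addCases (fun i => ?_) (fun j => ?_) m
  · exact hx.1 i
  · exact hy.1 j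

/-- **The product integrand on a cell is a word integrand**: reading the letters `Fin.append u v`
and the coordinates along any permutation `e` of `Fin (a + b)`,
`σᵃ⁺ᵇ ∏ₖ φ_{(u,v)(e k)}(z (e k)) = σᵃ ∏ᵢ uᵢ(xᵢ) · σᵇ ∏ⱼ vⱼ(yⱼ)`. [Chen 1977, (1.5.6)] [folklore] -/
theorem ellIntegrand_append_comp_equiv (γ : EllArc E) (u : Fin a → EllLetter)
    (v : Fin b → EllLetter) (e : Fin (a + b) ≃ Fin (a + b)) (z : Fin (a + b) → ℝ) :
    ellIntegrand γ (fun k => Fin.append u v (e k)) (fun k => z (e k)) =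
      ellIntegrand γ u (fun i => z (Fin.castAdd b i)) *
        ellIntegrand γ v (fun j => z (Fin.natAdd a j)) := by
  have hprod : ∏ k, (Fin.append u v (e k)).density γ (z (e k)) =
      ∏ m, (Fin.append u v m).density γ (z m) :=
    Equiv.prod_comp e (fun m => (Fin.append u v m).density γ (z m))
  simp only [ellIntegrand]
  rw [hprod, Fin.prod_univ_add, pow_add]
  simp only [Fin.append_left, Fin.append_right]
  ring

/-- The merged word of a coordinate shuffle of two adapted words is adapted (its letters are
letters of `u` or of `v`). [folklore] -/
theorem EllArc.Adapted.append_comp {γ : EllArc E} {u : Fin a → EllLetter} {v : Fin b → EllLetter}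
    (hu : γ.Adapted u) (hv : γ.Adapted v) (f : Fin n → Fin (a + b)) :
    γ.Adapted (fun k => Fin.append u v (f k)) := by
  intro k
  dsimp only
  generalize f k = m
  refine Fin.addCases (fun i => ?_) (fun j => ?_) m
  · rw [Fin.append_left]; exact hu i
  · rw [Fin.append_right]; exact hv j

/-! ### List words: the class of `∫_γ w` -/

/-- The adaptedness of a vector word transfers to the word re-read from its list of letters.
[folklore] -/
theorem EllArc.Adapted.get_ofFn {γ : EllArc E} {w : Fin n → EllLetter} (hw : γ.Adapted w) :
    γ.Adapted (List.ofFn w).get := fun i => by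
  rw [List.get_ofFn]; exact hw _

/-- Two representations of words with the same letters in possibly different (but equal)
dimensions have the same class in `FormalRep`. [folklore] -/
theorem of_ellIterRep_congr (γ : EllArc E) {m n : ℕ} (h : m = n) {w : Fin m → EllLetter}
    {w' : Fin n → EllLetter} (hw : γ.Adapted w) (hw' : γ.Adapted w')
    (hww' : ∀ i, w i = w' (Fin.cast h i)) : of (ellIterRep γ w hw) = of (ellIterRep γ w' hw') := by
  subst h
  obtain rfl : w = w' := funext fun i => by simpa using hww' i
  rfl

open Classical in
/-- **The class of the iterated integral of a list word.** For `w : List EllLetter` adapted to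
`γ` this is `[∫_γ w] = KZ.of (KZ.ellIterRep γ w.get _)`, the class in `KZ.FormalRep` of the
representation of dimension `w.length`; for a word not adapted to `γ` (a third-kind letter with a
pole on the closed arc or non-algebraic) the junk value `0`. Sums over shuffles
`Σ_{w ∈ u ш v} [∫_γ w]` are written `((MZV.shuffleWord u v).map (KZ.ellClass γ)).sum`.
[Chen 1977, §1.1, (1.5.6)] [folklore] -/
def ellClass (γ : EllArc E) (w : List EllLetter) : FormalRep :=
  if hw : γ.Adapted w.get then of (ellIterRep γ w.get hw) else 0

/-- The class of an adapted list word is the class of its representation. [folklore] -/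
theorem ellClass_of_adapted (γ : EllArc E) {w : List EllLetter} (hw : γ.Adapted w.get) :
    ellClass γ w = of (ellIterRep γ w.get hw) := by
  rw [ellClass, dif_pos hw]

/-- The class of a non-adapted list word is `0`. [folklore] -/
theorem ellClass_of_not_adapted (γ : EllArc E) {w : List EllLetter} (hw : ¬ γ.Adapted w.get) :
    ellClass γ w = 0 := by
  rw [ellClass, dif_neg hw]

/-- The class of the list of letters of a vector word `w` is `[KZ.ellIterRep γ w]`. [folklore] -/
theorem ellClass_ofFn (γ : EllArc E) (w : Fin n → EllLetter) (hw : γ.Adapted w) :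
    ellClass γ (List.ofFn w) = of (ellIterRep γ w hw) := by
  rw [ellClass_of_adapted γ hw.get_ofFn]
  exact of_ellIterRep_congr γ (List.length_ofFn (f := w)) _ _ fun i => List.get_ofFn w i

/-! ### The dissection -/

section Dissection

variable (γ : EllArc E) {u : Fin a → EllLetter} {v : Fin b → EllLetter}
  (hu : γ.Adapted u) (hv : γ.Adapted v) {N : ℕ} (e : Fin N → (Fin (a + b) ≃ Fin (a + b)))

/-- **The dissection** (rule (1a) iterated, then rule (2) once per cell). If the permutations
`e i` enumerate the coordinate shuffles bijectively through `i ↦ ofFn (e i)`, the product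
representation `[Δ_a(γ), u] · [Δ_b(γ), v]` minus the sum of the representations of the merged
words `Fin.append u v ∘ e i` is a relation: the cells `{z | z ∘ e i ∈ Δ_{a+b}(γ)}` lie in
`Δ_a(γ) × Δ_b(γ)`, carry its integrand, are pairwise disjoint and cover it off the null walls
`{xᵢ = yⱼ}` (`KZ.of_sub_sum_of_mem_relations_of_subset`), and each cell is the representation of its merged
word reindexed along `e i` (`KZ.of_sub_of_reindex_mem_relations`).
[Kontsevich–Zagier 2001, §1.2 rules (1), (2); Eie 2013, §1.2] [cite: KontsevichZagier2001, §1.2] -/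
theorem of_prod_sub_sum_of_ellIterRep_mem_relations
    (hmem : ∀ i, List.ofFn (e i) ∈
      MZV.shuffleWord (List.ofFn (Fin.castAdd b : Fin a → Fin (a + b))) (List.ofFn (Fin.natAdd a)))
    (hinj : ∀ i j, List.ofFn (e i) = List.ofFn (e j) → i = j)
    (hsurj : ∀ w ∈ MZV.shuffleWord (List.ofFn (Fin.castAdd b : Fin a → Fin (a + b)))
      (List.ofFn (Fin.natAdd a)), ∃ i, List.ofFn (e i) = w) :
    of ((ellIterRep γ u hu).prod (ellIterRep γ v hv)) -
      ∑ i, of (ellIterRep γ _ ((hu.append_comp hv) (e i))) ∈ relations := by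
  -- rule (1a): the cells, as reindexed word representations, dissect the product
  have h1 : of ((ellIterRep γ u hu).prod (ellIterRep γ v hv)) -
      ∑ i, of ((ellIterRep γ _ ((hu.append_comp hv) (e i))).reindex (e i)) ∈ relations := by
    refine of_sub_sum_of_mem_relations_of_subset Finset.univ _
      (fun i => (ellIterRep γ _ ((hu.append_comp hv) (e i))).reindex (e i)) (fun i _ z hz => ?_)
      (fun i _ z _ => ?_) ?_ ?_
    · -- cells lie in the product
      have hz' : (fun k => z (e i k)) ∈ ellDomain γ (a + b) := hz
      rw [IntegralRep.prod_domain, IntegralRep.mem_prodDomain, ellIterRep_domain, ellIterRep_domain]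
      exact mem_ellDomain_of_comp_mem_ellDomain γ (hmem i) hz'
    · -- integrands agree
      rw [IntegralRep.prod_integrand_eq, IntegralRep.prodFun_apply]
      simp only [IntegralRep.reindex_integrand, ellIterRep_integrand]
      exact ellIntegrand_append_comp_equiv γ u v (e i) z
    · -- cover off the null walls
      refine measure_mono_null (fun z hz => ?_)
        (measure_iUnion_null_iff.2 fun i : Fin a => measure_iUnion_null_iff.2 fun j : Fin b =>
          volume_setOf_apply_eq_apply (n := a + b) (i := Fin.castAdd b i) (j := Fin.natAdd a j)
            fun h => absurd (congrArg Fin.val h) (by simp; omega))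
      rw [Set.mem_sdiff, IntegralRep.prod_domain, IntegralRep.mem_prodDomain,
        ellIterRep_domain, ellIterRep_domain] at hz
      obtain ⟨⟨hx, hy⟩, hz⟩ := hz
      by_contra hne
      simp only [mem_iUnion, mem_setOf_eq, not_exists] at hne
      obtain ⟨e₀, he₀, hz₀⟩ := exists_comp_mem_ellDomain γ hx hy hne
      obtain ⟨i, hi⟩ := hsurj _ he₀
      have hei : e i = e₀ := Equiv.ext (congrFun (List.ofFn_injective hi))
      refine hz (mem_iUnion₂.2 ⟨i, Finset.mem_univ _, ?_⟩)
      show (fun k => z (e i k)) ∈ ellDomain γ (a + b)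
      rw [hei]
      exact hz₀
    · -- pairwise disjoint
      intro i _ j _ hij
      refine Set.disjoint_left.2 fun z hzi hzj => hij (hinj i j ?_)
      have hzi' : (fun k => z (e i k)) ∈ ellDomain γ (a + b) := hzi
      have hzj' : (fun k => z (e j k)) ∈ ellDomain γ (a + b) := hzj
      exact ofFn_eq_of_comp_mem_ellDomain γ hzi' hzj'
  -- rule (2): each cell is a coordinate permutation of the word representation
  have h2 : ∑ i, (of (ellIterRep γ _ ((hu.append_comp hv) (e i))) -
      of ((ellIterRep γ _ ((hu.append_comp hv) (e i))).reindex (e i))) ∈ relations :=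
    sum_mem fun i _ => of_sub_of_reindex_mem_relations _ _
  rw [Finset.sum_sub_distrib] at h2
  convert relations.sub_mem h1 h2 using 1
  abel

/-- **The merged words are the shuffles**: along a bijective enumeration of the coordinate
shuffles, the sum of the classes of the merged-word representations is the sum of the classes
`[∫_γ w]` over `w ∈ MZV.shuffleWord (ofFn u) (ofFn v)` with multiplicity (naturality of `ш`
under the letters `Fin.append u v`). [Eie 2013, §1.2; Reutenauer 1993, §1.4] [folklore] -/
theorem sum_of_ellIterRep_eq
    (hmem : ∀ i, List.ofFn (e i) ∈
      MZV.shuffleWord (List.ofFn (Fin.castAdd b : Fin a → Fin (a + b))) (List.ofFn (Fin.natAdd a)))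
    (hinj : ∀ i j, List.ofFn (e i) = List.ofFn (e j) → i = j)
    (hsurj : ∀ w ∈ MZV.shuffleWord (List.ofFn (Fin.castAdd b : Fin a → Fin (a + b)))
      (List.ofFn (Fin.natAdd a)), ∃ i, List.ofFn (e i) = w) :
    ∑ i, of (ellIterRep γ _ ((hu.append_comp hv) (e i))) =
      ((MZV.shuffleWord (List.ofFn u) (List.ofFn v)).map (ellClass γ)).sum := by
  classical
  have hl : List.ofFn u =
      (List.ofFn (Fin.castAdd b : Fin a → Fin (a + b))).map (Fin.append u v) := by
    rw [List.map_ofFn]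
    exact congrArg List.ofFn (funext fun i => by simp)
  have hr : List.ofFn v =
      (List.ofFn (Fin.natAdd a : Fin b → Fin (a + b))).map (Fin.append u v) := by
    rw [List.map_ofFn]
    exact congrArg List.ofFn (funext fun j => by simp)
  have hnd : (MZV.shuffleWord (List.ofFn (Fin.castAdd b : Fin a → Fin (a + b)))
      (List.ofFn (Fin.natAdd a))).Nodup :=
    MZV.nodup_shuffleWord _ _
      (by rw [ofFn_castAdd_append_ofFn_natAdd]; exact List.nodup_finRange _)
  rw [hl, hr, MZV.shuffleWord_map, List.map_map, ← List.sum_toFinset _ hnd]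
  refine Finset.sum_bij (fun i _ => List.ofFn (e i)) (fun i _ => List.mem_toFinset.2 (hmem i))
    (fun i _ j _ h => hinj i j h) (fun w hw => ?_) (fun i _ => ?_)
  · obtain ⟨i, hi⟩ := hsurj w (List.mem_toFinset.1 hw)
    exact ⟨i, Finset.mem_univ _, hi⟩
  · rw [Function.comp_apply, List.map_ofFn]
    exact (ellClass_ofFn γ _ ((hu.append_comp hv) (e i))).symm

end Dissection

/-! ### The shuffle product formula -/

/-- **Shuffle product formula for genus-one iterated integrals, in the KZ calculus** (vector
words). For words `u = (φ₀, …, φ_{a−1})`, `v = (ψ₀, …, ψ_{b−1})` of algebraic `1`-forms adapted to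
a monotone arc `γ` of the real oval,

  `[∫_γ u] · [∫_γ v] − Σ_{w ∈ u ш v} [∫_γ w] ∈ KZ.relations`,

the sum over the tree's shuffle product `MZV.shuffleWord` of the two lists of letters, with
multiplicity: the shuffle cells dissect `Δ_a(γ) × Δ_b(γ)` off the null tie walls (rule (1a)) and
each cell is one coordinate permutation (rule (2)) of the representation of a shuffled word.
Hence (`KZ.ellIterRep_value_mul_value`) Ree–Chen's formula
`∫_γ u · ∫_γ v = Σ_{w ∈ u ш v} ∫_γ w` for the values.
[Chen 1977, (1.5.6); Eie 2013, §1.2; Kontsevich–Zagier 2001, §1.2 rules (1), (2)]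
[cite: Chen1977, (1.5.6)] -/
theorem of_ellIterRep_mul_of_ellIterRep_sub_sum_mem_relations (γ : EllArc E)
    (u : Fin a → EllLetter) (v : Fin b → EllLetter) (hu : γ.Adapted u) (hv : γ.Adapted v) :
    of (ellIterRep γ u hu) * of (ellIterRep γ v hv) -
      ((MZV.shuffleWord (List.ofFn u) (List.ofFn v)).map (ellClass γ)).sum ∈ relations := by
  obtain ⟨N, e, hmem, hinj, hsurj⟩ := exists_enum_coordShuffles a b
  rw [of_mul_of, ← sum_of_ellIterRep_eq γ hu hv e hmem hinj hsurj]
  exact of_prod_sub_sum_of_ellIterRep_mem_relations γ hu hv e hmem hinj hsurj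

/-- **Shuffle product formula, list words**: for list words `u`, `v` adapted to `γ`,
`[∫_γ u] · [∫_γ v] − Σ_{w ∈ u ш v} [∫_γ w] ∈ KZ.relations` with `[∫_γ w] = KZ.ellClass γ w`.
[Chen 1977, (1.5.6); Eie 2013, §1.2] [cite: Chen1977, (1.5.6)] -/
theorem ellClass_mul_ellClass_sub_sum_mem_relations (γ : EllArc E) (u v : List EllLetter)
    (hu : γ.Adapted u.get) (hv : γ.Adapted v.get) :
    ellClass γ u * ellClass γ v - ((MZV.shuffleWord u v).map (ellClass γ)).sum ∈ relations := by
  have h := of_ellIterRep_mul_of_ellIterRep_sub_sum_mem_relations γ u.get v.get hu hv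
  rw [List.ofFn_get, List.ofFn_get] at h
  rwa [ellClass_of_adapted γ hu, ellClass_of_adapted γ hv]

/-- Every shuffle of two words adapted to `γ` is adapted to `γ` (its letters are letters of `u`
or of `v`), so that no junk term enters the sums over shuffles. [folklore] -/
theorem EllArc.Adapted.of_mem_shuffleWord {γ : EllArc E} {u v w : List EllLetter}
    (hu : γ.Adapted u.get) (hv : γ.Adapted v.get) (hw : w ∈ MZV.shuffleWord u v) :
    γ.Adapted w.get := by
  intro k
  have hk : w.get k ∈ u ++ v := (MZV.perm_of_mem_shuffleWord u v hw).mem_iff.1 (List.get_mem w k)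
  rcases List.mem_append.1 hk with h | h
  · obtain ⟨i, hi⟩ := List.get_of_mem h
    rw [← hi]; exact hu i
  · obtain ⟨j, hj⟩ := List.get_of_mem h
    rw [← hj]; exact hv j

/-- **Ree–Chen's shuffle product formula for the values**:
`∫_γ u · ∫_γ v = Σ_{w ∈ u ш v} ∫_γ w`, by soundness of the KZ calculus
(`KZ.relations_le_ker_eval_holds`) and multiplicativity of `KZ.eval` (`KZ.eval_mul'`).
[Chen 1977, (1.5.6)] [cite: Chen1977, (1.5.6)] -/
theorem ellIterRep_value_mul_value (γ : EllArc E) (u : Fin a → EllLetter) (v : Fin b → EllLetter)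
    (hu : γ.Adapted u) (hv : γ.Adapted v) :
    (ellIterRep γ u hu).value * (ellIterRep γ v hv).value =
      ((MZV.shuffleWord (List.ofFn u) (List.ofFn v)).map fun w => eval (ellClass γ w)).sum := by
  have h := relations_le_ker_eval_holds
    (of_ellIterRep_mul_of_ellIterRep_sub_sum_mem_relations γ u v hu hv)
  rw [AddMonoidHom.mem_ker, map_sub, sub_eq_zero, eval_mul', eval_of, eval_of, map_list_sum,
    List.map_map] at h
  exact h

/-! ### Examples -/

/-- `ω ш η = {ωη, ηω}`: the depth-one instance `[I(ω)][I(η)] − [I(ωη)] − [I(ηω)] ∈ relations`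
behind `I(ωη) + I(ηω) = I(ω) I(η)` on any arc. [Chen 1977, (1.5.6)] [folklore] -/
example (γ : EllArc E) :
    ellClass γ [EllLetter.ω] * ellClass γ [EllLetter.η] -
      (ellClass γ [EllLetter.ω, EllLetter.η] + ellClass γ [EllLetter.η, EllLetter.ω]) ∈
        relations := by
  have h := ellClass_mul_ellClass_sub_sum_mem_relations γ [EllLetter.ω] [EllLetter.η]
    (fun k => by fin_cases k; exact trivial) (fun k => by fin_cases k; exact trivial)
  simpa using h

/-- `ω ш ωη = 2·ωωη + ωηω` (multiplicities count): `[I(ω)][I(ωη)] − (2[I(ωωη)] + [I(ωηω)])` is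
a relation — the shuffle relating the depth-three coordinate `I(ωωη)` of the route's items
DepthThreeFamily / DepthThreeLemniscatic to products of shorter integrals. [Chen 1977, (1.5.6)]
[folklore] -/
example (γ : EllArc E) :
    ellClass γ [EllLetter.ω] * ellClass γ [EllLetter.ω, EllLetter.η] -
      (2 • ellClass γ [EllLetter.ω, EllLetter.ω, EllLetter.η] +
        ellClass γ [EllLetter.ω, EllLetter.η, EllLetter.ω]) ∈ relations := by
  have h := ellClass_mul_ellClass_sub_sum_mem_relations γ [EllLetter.ω]
    [EllLetter.ω, EllLetter.η] (fun k => by fin_cases k; exact trivial)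
    (fun k => by fin_cases k <;> exact trivial)
  have e : ((MZV.shuffleWord [EllLetter.ω] [EllLetter.ω, EllLetter.η]).map (ellClass γ)).sum =
      2 • ellClass γ [EllLetter.ω, EllLetter.ω, EllLetter.η] +
        ellClass γ [EllLetter.ω, EllLetter.η, EllLetter.ω] := by
    simp [two_nsmul, add_assoc]
  rwa [e] at h

end KZ

end Literature.NumberTheory.Transcendental
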